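import Summits.QuantumFields.BalabanUV.Beta.GAN24.SubAveragingKernel
import Summits.QuantumFields.BalabanUV.Beta.FP.ConstrainedBiLaplacianFibreOperator

/-!
# `BalabanUV.Beta.GAN24.SubAveragingKernelL2` — binder row G-an2-4 ∕ (CONV-C), programme «SUBAVG-RATE», FILE 5:
# THE n-FREE BLOCK-`ℓ²` (RMS) CURRENCY OF THE END — the sub-cell-averaged finer kernel of `G_jQ_j^*` minus the coarser kernel has
# ROOT-MEAN-SQUARE over the `n^{d+1}` fine sites of a unit block `≤ 48^{d+1}·Ccol∕n² · e^{−κ|x|_∞}`: the SHARP exponent `θ = L⁻²` with NO logarithm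

NOT IN PRINT; OUR PROOF ATTEMPT (prover part P3 of row G-an2-4, fibre∕strip lineage, gen 22; CRUX TEAM (2), ruling «YM REDIRECT TOWARDS THE
SUMMIT», 2026-08-21).  HONEST DEPENDENCY (cell records, verbatim): «continuum YM on T⁴ ⇐ BetaPertH ∧ nine spine estimates (0/9 proved);
BetaPertH ⇐ (D1) ∧ (D4) ∧ CAP+tail; G-an2-4 gates asym, D1 and NE2/3/4.»  HONEST FRAMING (cell contract, verbatim): «discharging `BetaPertH`
makes Bałaban's UV stability UNCONDITIONAL — a real constructive-QFT result; it is NOT the continuum limit and NOT the Clay problem.»  ABSOLUTE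
RULE: nothing printed is a hypothesis.  [folklore] assembly over the tree's `B4StripSums` (`F`, `G`, `v`, `norm_v_le`), `B4ContourShift`
(`latticeKernel`, `StripRegular`, `latticeKernel_decay`), the lineage's gen-21 Parseval tools `FP/ConstrainedBiLaplacianKernel` (`EF`),
`FP/ConstrainedBiLaplacianParseval` (`sqNorm`, `Adft`, **`sqNorm_Adft_le`** — the twisted box-DFT Parseval bound, `norm_sum_mul_mul_le`),
`FP/ConstrainedBiLaplacianFibreOperator` (`sum_prod_sq_le`), and the siblings `SubAveraging*` (FILE 4's `Dmult`, `stripRegular_Dmult`,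
`latticeKernel_avgG`, FILE 3b's `norm_colDiff_le`).  No `def … : Prop`, no sorry.

## Why a second currency
FILE 4's END is ENTRYWISE and carries the alias weight `HF(n) ≍ (48 log n)^{d+1}` — the block-corner logarithm of the sharp block-averaging
numerator `u(p+2πk) ∼ Π_ν 1∕k_ν` summed in `ℓ¹`.  Pairing the fine-site index `τ` against a test vector `f` and using Parseval over the
`n^{d+1}` characters `k ↦ e^{2πik·τ∕n}` (gen 21, road-FP RHOA-4-GH FILE 4a) trades `Σ_k|u_k|` for `(Σ_k|u_k|²)^{1∕2} ≤ 24^{d+1}` — n-FREE.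
In the resulting ROOT-MEAN-SQUARE currency over the block the one-step rate is EXACTLY `θ = L⁻²` (constant `48^{d+1}·Ccol`), matching the
operator-norm currency of the T⁴ spine's `OneStepAveragedLaw` (`Spine/CovariantAveragingTower`) up to the passage block-RMS ↔ operator norm.

## What is proved
* §1 `Vprod` (`Π_ν v n k_ν`), `F_eq_EF_mul_Vprod`, `sqNorm_Vprod_le` (`Σ_k‖Vprod‖² ≤ 576^{d}`), the block pairing `PhiD f := Σ_τ conj(f τ)·Dmult τ`,
  `PhiD_eq` (`= Σ_k Adft f k · Vprod k · colDiff k`), **`norm_PhiD_le`** (`≤ Ccol∕n² · √(n^d 4^d ‖f‖₂²)·√(576^d)` on the thin fat region).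
* §2 `stripRegular_PhiD`, `latticeKernel_PhiD` (linearity), **`subavg_kernel_rate_pairing`** and the RMS form **`subavg_kernel_rate_rms`**:
  `√(Σ_τ ‖(L^{d+1})⁻¹Σ_ρ K_{nL}(x, Lτ+ρ) − K_n(x,τ)‖²) ≤ 48^{d+1}·√(n^{d+1})·Ccol∕n²·e^{−κ|x|_∞}`, i.e. RMS over the block `≤ 48^{d+1}·Ccol∕n²·e^{−κ|x|_∞}`.

HONEST: as FILE 4 — `U = 1`, scalar constituent `G_jQ_j^*` of B4 (2.48) only, sub-averaged fine leg; NOT `H_k` (1.63), NOT composites, NOT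
`U ≠ 1`, NOT (ρ2)(ρ3); NEVER «G-an2-4 closed»; NOT D1, NOT BetaPertH, NOT continuum, NOT Clay.  Provenance: prover-b2b-balaban-gan24-p3-g22-0
(unit `b2b-balaban-gan24-p3`, gen 22), 2026-08-21.
-/

noncomputable section

namespace Summit.QuantumFields.BalabanUV.Beta.GAN24.SubAveragingKernelL2

open Complex Finset MeasureTheory ComplexConjugate
open Literature.MathematicalPhysics.QuantumFieldTheory.Balaban1983to89
open Literature.MathematicalPhysics.QuantumFieldTheory.Balaban1983to89.B4Strip
open Literature.MathematicalPhysics.QuantumFieldTheory.Balaban1983to89.B4StripCauchy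
open Literature.MathematicalPhysics.QuantumFieldTheory.Balaban1983to89.B4StripSums
open Literature.MathematicalPhysics.QuantumFieldTheory.Balaban1983to89.B4ContourShift
open Literature.MathematicalPhysics.QuantumFieldTheory.Balaban1983to89.B5Strip145Analytic (strip_mono kappa_small)
open Summit.QuantumFields.BalabanUV.Beta.FP.ConstrainedBiLaplacianKernel (EF)
open Summit.QuantumFields.BalabanUV.Beta.FP.ConstrainedBiLaplacianParseval (sqNorm sqNorm_nonneg Adft sqNorm_Adft_le norm_sum_mul_mul_le)
open Summit.QuantumFields.BalabanUV.Beta.FP.ConstrainedBiLaplacianFibreOperator (sum_prod_sq_le)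
open Summit.QuantumFields.BalabanUV.Beta.GAN24.SubAveragingDirichlet
open Summit.QuantumFields.BalabanUV.Beta.GAN24.SubAveragingCore
open Summit.QuantumFields.BalabanUV.Beta.GAN24.SubAveragingCoreEstimate
open Summit.QuantumFields.BalabanUV.Beta.GAN24.SubAveragingFibre
open Summit.QuantumFields.BalabanUV.Beta.GAN24.SubAveragingFibreColumn
open Summit.QuantumFields.BalabanUV.Beta.GAN24.SubAveragingKernel
open scoped Real

variable {d : ℕ}

/-! ## §1 The block pairing of the difference multiplier and its n-free Parseval bound -/

/-- [folklore] the product of the one-coordinate block-averaging factors of the alias `k`: `Vprod n k p = Π_ν v n k_ν p_ν` (continued `u(p+2πk)`). -/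
def Vprod (n : ℕ) (k : Fin d → Fin n) (p : Fin d → ℂ) : ℂ := ∏ ν, v n (k ν : ℕ) (p ν)

/-- [folklore] B4's numerator splits as phase × averaging factor: `F n τ k p = EF n τ k p · Vprod n k p`. -/
theorem F_eq_EF_mul_Vprod (n : ℕ) (τ k : Fin d → Fin n) (p : Fin d → ℂ) : F n τ k p = EF n τ k p * Vprod n k p := by
  unfold F EF Vprod
  rw [← Finset.prod_mul_distrib]

/-- [folklore] `Σ_k ‖Vprod n k p‖² ≤ 576^d` on the fat region (`‖v‖ ≤ 12∕ω` and the lineage's `sum_prod_sq_le`) — the averaging factors are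
SQUARE-summable over the aliases with an n-FREE bound (they are NOT `ℓ¹`-summable n-free: that is FILE 4's logarithm). -/
theorem sqNorm_Vprod_le (n : ℕ) [NeZero n] {r : ℝ} (hr : r ≤ 1 / 4) {p : Fin d → ℂ} (hp : p ∈ Fat d r) :
    sqNorm (fun k : Fin d → Fin n => Vprod n k p) ≤ (576 : ℝ) ^ d := by
  unfold sqNorm
  refine le_trans (Finset.sum_le_sum fun k _ => ?_) (sum_prod_sq_le (d := d) n)
  unfold Vprod
  rw [norm_prod, ← Finset.prod_pow]
  exact Finset.prod_le_prod (fun ν _ => sq_nonneg _) fun ν _ =>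
    pow_le_pow_left₀ (norm_nonneg _) (norm_v_le n (k ν) hr (hp ν).1 (hp ν).2) 2

/-- [folklore] THE BLOCK PAIRING of the difference multiplier against a test vector `f` on the coarse fine sites of a unit block:
`PhiD f p = Σ_τ conj(f τ) · Dmult τ p`. -/
def PhiD (n L : ℕ) [NeZero n] [NeZero L] (a m2 : ℝ) (f : (Fin d → Fin n) → ℂ) (p : Fin d → ℂ) : ℂ :=
  ∑ τ : Fin d → Fin n, conj (f τ) * Dmult n L a m2 τ p

/-- [folklore] **`PhiD f = Σ_k Adft f k · Vprod k · colDiff k`** (the twisted box-DFT of `f` appears alias by alias). -/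
theorem PhiD_eq (n L : ℕ) [NeZero n] [NeZero L] (a m2 : ℝ) (f : (Fin d → Fin n) → ℂ) (p : Fin d → ℂ) :
    PhiD n L a m2 f p = ∑ k : Fin d → Fin n, Adft n f k p * Vprod n k p * colDiff n L a m2 k p := by
  unfold PhiD Adft
  simp_rw [Dmult_eq, F_eq_EF_mul_Vprod, Finset.mul_sum, Finset.sum_mul]
  rw [Finset.sum_comm]
  refine Finset.sum_congr rfl fun k _ => Finset.sum_congr rfl fun τ _ => by ring

/-- [folklore] **THE n-FREE PAIRING BOUND**: on the fat region `Fat d r` (`r ≤ 1∕4`, `d r² ≤ 1∕16`), given the common lower bound `c ≤ ‖E‖` at the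
two levels, `‖PhiD f p‖ ≤ Ccol∕n² · √(n^d·4^d·‖f‖₂²) · √(576^d)` (Cauchy–Schwarz over the aliases; Parseval for `Adft`; `sqNorm_Vprod_le`). -/
theorem norm_PhiD_le (n L : ℕ) [NeZero n] [NeZero L] (a m2 : ℝ) (ha : 0 ≤ a) (hm : 0 ≤ m2) {r : ℝ} (hr : r ≤ 1 / 4)
    (hdr : (d : ℝ) * r ^ 2 ≤ 1 / 16) {p : Fin d → ℂ} (hp : p ∈ Fat d r) {c : ℝ} (hc : 0 < c) (hcE : c ≤ ‖E n a m2 p‖)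
    (hcE' : c ≤ ‖E (n * L) a m2 p‖) (f : (Fin d → Fin n) → ℂ) :
    ‖PhiD n L a m2 f p‖ ≤ Ccol d L a m2 c / (n : ℝ) ^ 2
      * (Real.sqrt ((n : ℝ) ^ d * 4 ^ d * sqNorm f) * Real.sqrt ((576 : ℝ) ^ d)) := by
  rw [PhiD_eq]
  have hIm : ∀ ν, |(p ν).im| ≤ 1 / 2 := fun ν => (hp ν).2.trans (by linarith)
  have h1 := norm_sum_mul_mul_le (fun k => Adft n f k p) (fun k => Vprod n k p) (fun k => colDiff n L a m2 k p)
    (Dm := Ccol d L a m2 c / (n : ℝ) ^ 2) (div_nonneg (Ccol_nonneg d L ha hm hc) (sq_nonneg _))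
    (fun k => norm_colDiff_le n L a m2 ha hm hr hdr hp hc hcE hcE' k)
  refine h1.trans (mul_le_mul_of_nonneg_left ?_ (div_nonneg (Ccol_nonneg d L ha hm hc) (sq_nonneg _)))
  exact mul_le_mul (Real.sqrt_le_sqrt (sqNorm_Adft_le n f hIm)) (Real.sqrt_le_sqrt (sqNorm_Vprod_le n hr hp))
    (Real.sqrt_nonneg _) (Real.sqrt_nonneg _)

/-! ## §2 Strip regularity of the pairing, its kernel, and the END in the block-`ℓ²` currency -/

/-- [folklore] the pairing multiplier is strip regular with the n-free pairing bound (fields from FILE 4's `stripRegular_Dmult`, summed). -/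
theorem stripRegular_PhiD (n L : ℕ) [NeZero n] [NeZero L] (a m2 m2plus : ℝ) (ha : 0 ≤ a) (hm : 0 ≤ m2) (hmp : m2 ≤ m2plus)
    {κ c : ℝ} (hκ0 : 0 ≤ κ) (hκr : κ ≤ rOf (d + 1)) (hc : 0 < c)
    (hE : ∀ p ∈ Strip (d + 1) κ, c ≤ ‖E n a m2 p‖) (hE' : ∀ p ∈ Strip (d + 1) κ, c ≤ ‖E (n * L) a m2 p‖)
    (f : (Fin (d + 1) → Fin n) → ℂ) :
    StripRegular (d := d) (PhiD n L a m2 f) κ (Ccol (d + 1) L a m2 c / (n : ℝ) ^ 2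
      * (Real.sqrt ((n : ℝ) ^ (d + 1) * 4 ^ (d + 1) * sqNorm f) * Real.sqrt ((576 : ℝ) ^ (d + 1)))) := by
  have hsum := stripRegular_finsum (Finset.univ : Finset (Fin (d + 1) → Fin n))
    (fun τ p => conj (f τ) * Dmult n L a m2 τ p) (fun τ => ‖conj (f τ)‖ * (HF n (d + 1) * Ccol (d + 1) L a m2 c / (n : ℝ) ^ 2))
    (fun τ _ => (stripRegular_const (conj (f τ)) κ).mul (stripRegular_Dmult n L a m2 m2plus ha hm hmp τ hκ0 hκr hc hE hE') (norm_nonneg _))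
  have hr4 : rOf (d + 1) ≤ 1 / 4 := by
    unfold rOf
    rw [div_le_div_iff₀ (by positivity) (by norm_num)]
    have : (0 : ℝ) ≤ d := Nat.cast_nonneg d
    push_cast; nlinarith
  have hdr : ((d + 1 : ℕ) : ℝ) * rOf (d + 1) ^ 2 ≤ 1 / 16 := by
    have h := (kappa_small (d := d + 1) (le_of_lt (rOf_pos (d + 1))) le_rfl).2
    exact_mod_cast h
  refine ⟨hsum.cont, hsum.diff, hsum.sides, fun p hp => ?_⟩
  have hpF : p ∈ Fat (d + 1) (rOf (d + 1)) := strip_subset_fat (le_of_lt (rOf_pos (d + 1))) hκr hp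
  exact norm_PhiD_le n L a m2 ha hm hr4 (by exact_mod_cast hdr) hpF hc (hE p hp) (hE' p hp) f

/-- [folklore] the kernel of the pairing is the pairing of the kernels (linearity of the Brillouin-zone integral). -/
theorem latticeKernel_PhiD (n L : ℕ) [NeZero n] [NeZero L] (a m2 m2plus : ℝ) (ha : 0 ≤ a) (hm : 0 ≤ m2) (hmp : m2 ≤ m2plus)
    {κ c : ℝ} (hκ0 : 0 ≤ κ) (hκr : κ ≤ rOf (d + 1)) (hc : 0 < c)
    (hE : ∀ p ∈ Strip (d + 1) κ, c ≤ ‖E n a m2 p‖) (hE' : ∀ p ∈ Strip (d + 1) κ, c ≤ ‖E (n * L) a m2 p‖)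
    (f : (Fin (d + 1) → Fin n) → ℂ) (x : Fin (d + 1) → ℤ) :
    latticeKernel (PhiD n L a m2 f) x = ∑ τ : Fin (d + 1) → Fin n, conj (f τ) * latticeKernel (Dmult n L a m2 τ) x := by
  have hint : ∀ τ : Fin (d + 1) → Fin n, IntegrableOn (integrand (Dmult n L a m2 τ) x) (BZ (d + 1)) := fun τ =>
    (stripRegular_Dmult n L a m2 m2plus ha hm hmp τ hκ0 hκr hc hE hE').integrableOn hκ0 x
  unfold latticeKernel fourierBox
  have e : (fun q => integrand (PhiD n L a m2 f) x q)
      = fun q => ∑ τ : Fin (d + 1) → Fin n, conj (f τ) * integrand (Dmult n L a m2 τ) x q := by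
    funext q
    unfold integrand PhiD
    rw [Finset.sum_mul]
    exact Finset.sum_congr rfl fun τ _ => by ring
  rw [show (∫ q in BZ (d + 1), integrand (PhiD n L a m2 f) x q)
      = ∫ q in BZ (d + 1), ∑ τ : Fin (d + 1) → Fin n, conj (f τ) * integrand (Dmult n L a m2 τ) x q from by rw [e]]
  rw [integral_finsetSum _ (fun τ _ => (hint τ).const_mul _)]
  simp only [integral_const_mul, Complex.real_smul, Finset.mul_sum]
  exact Finset.sum_congr rfl fun τ _ => by ring

/-- [folklore] **THE END IN PAIRING FORM.**  For `0 < a₋ ≤ a₊`, `m²₊`, `L ≥ 1` there are `κ, c > 0` such that for EVERY `n ≥ 1`, `a ∈ [a₋,a₊]`,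
`m² ∈ [0,m²₊]`, every test vector `f` on the `n^{d+1}` coarse fine sites and every `x ∈ ℤ^{d+1}`:
`‖Σ_τ conj(f τ)·[(L^{d+1})⁻¹Σ_ρ latticeKernel (G (n·L) a m2 (Tsub τ ρ)) x − latticeKernel (G n a m2 τ) x]‖
 ≤ Ccol∕n² · √(n^{d+1}4^{d+1}‖f‖₂²)·√(576^{d+1}) · e^{−κ|x|_∞}` — n-FREE apart from `√(n^{d+1})·‖f‖₂`, the `ℓ²`-size of the block. -/
theorem subavg_kernel_rate_pairing (d : ℕ) (aminus aplus m2plus : ℝ) (ha : 0 < aminus) (L : ℕ) [NeZero L] :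
    ∃ κ c : ℝ, 0 < κ ∧ 0 < c ∧ ∀ (n : ℕ) [NeZero n] (a m2 : ℝ), aminus ≤ a → a ≤ aplus → 0 ≤ m2 → m2 ≤ m2plus →
      ∀ (f : (Fin (d + 1) → Fin n) → ℂ) (x : Fin (d + 1) → ℤ),
        ‖∑ τ : Fin (d + 1) → Fin n, conj (f τ) *
            (((L : ℂ) ^ (d + 1))⁻¹ * ∑ ρ : Fin (d + 1) → Fin L, latticeKernel (G (n * L) a m2 (Tsub n L τ ρ)) x
              - latticeKernel (G n a m2 τ) x)‖
          ≤ Ccol (d + 1) L a m2 c / (n : ℝ) ^ 2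
            * (Real.sqrt ((n : ℝ) ^ (d + 1) * 4 ^ (d + 1) * sqNorm f) * Real.sqrt ((576 : ℝ) ^ (d + 1)))
            * Real.exp (-(κ * supNorm x)) := by
  obtain ⟨κ₁, c, hκ₁, hc, h⟩ := uniformStrip_holds (d + 1) aminus aplus m2plus ha
  refine ⟨min κ₁ (rOf (d + 1)), c, lt_min hκ₁ (rOf_pos _), hc, ?_⟩
  intro n _ a m2 ha1 ha2 hm hmp f x
  have hκ0 : 0 ≤ min κ₁ (rOf (d + 1)) := (lt_min hκ₁ (rOf_pos _)).le
  have hsub : Strip (d + 1) (min κ₁ (rOf (d + 1))) ⊆ Strip (d + 1) κ₁ := strip_mono (min_le_left _ _)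
  have hE : ∀ p ∈ Strip (d + 1) (min κ₁ (rOf (d + 1))), c ≤ ‖E n a m2 p‖ := fun p hp => h n a m2 ha1 ha2 hm hmp p (hsub hp)
  have hE' : ∀ p ∈ Strip (d + 1) (min κ₁ (rOf (d + 1))), c ≤ ‖E (n * L) a m2 p‖ := fun p hp =>
    h (n * L) a m2 ha1 ha2 hm hmp p (hsub hp)
  have ha0 : 0 ≤ a := le_trans ha.le ha1
  have hreg := stripRegular_PhiD n L a m2 m2plus ha0 hm hmp hκ0 (min_le_right _ _) hc hE hE' f
  have hdecay := latticeKernel_decay hreg hκ0 x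
  rw [latticeKernel_PhiD n L a m2 m2plus ha0 hm hmp hκ0 (min_le_right _ _) hc hE hE' f x] at hdecay
  have e : ∀ τ : Fin (d + 1) → Fin n,
      ((L : ℂ) ^ (d + 1))⁻¹ * ∑ ρ : Fin (d + 1) → Fin L, latticeKernel (G (n * L) a m2 (Tsub n L τ ρ)) x - latticeKernel (G n a m2 τ) x
        = latticeKernel (Dmult n L a m2 τ) x := by
    intro τ
    rw [← latticeKernel_avgG n L a m2 m2plus hm hmp τ hκ0 (min_le_right _ _) hc hE' x]
    have hint1 := (stripRegular_avgG n L a m2 m2plus hm hmp τ hκ0 (min_le_right _ _) hc hE').integrableOn hκ0 x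
    have hint2 := (stripRegular_G n a m2 m2plus hm hmp τ hκ0 (min_le_right _ _) hc hE).integrableOn hκ0 x
    unfold latticeKernel fourierBox
    rw [← smul_sub, ← integral_sub hint1 hint2]
    congr 1
    refine setIntegral_congr_fun (by unfold BZ; exact measurableSet_Icc) fun q _ => ?_
    simp only [integrand, Dmult]
    ring
  simp_rw [e]
  exact hdecay

/-- [folklore] from a self-pairing bound to a norm bound: if `Σ_τ ‖K τ‖² ≤ B·√(Σ_τ ‖K τ‖²)` with `B ≥ 0` then `√(Σ_τ ‖K τ‖²) ≤ B`. -/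
theorem sqrt_sqNorm_le_of_self_pairing {ι : Type*} [Fintype ι] (K : ι → ℂ) {B : ℝ} (hB : 0 ≤ B)
    (h : sqNorm K ≤ B * Real.sqrt (sqNorm K)) : Real.sqrt (sqNorm K) ≤ B := by
  have h0 := sqNorm_nonneg K
  by_cases hz : Real.sqrt (sqNorm K) = 0
  · rw [hz]; exact hB
  · have hpos : 0 < Real.sqrt (sqNorm K) := lt_of_le_of_ne (Real.sqrt_nonneg _) (Ne.symm hz)
    have h2 : Real.sqrt (sqNorm K) * Real.sqrt (sqNorm K) ≤ B * Real.sqrt (sqNorm K) := by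
      rw [Real.mul_self_sqrt h0]; exact h
    exact le_of_mul_le_mul_right h2 hpos

/-- [folklore] **THE END IN THE n-FREE ROOT-MEAN-SQUARE CURRENCY.**  Same `κ, c`; for every `n, a, m², x`, with
`K(x,τ) := (L^{d+1})⁻¹Σ_ρ latticeKernel (G (n·L) a m2 (Tsub τ ρ)) x − latticeKernel (G n a m2 τ) x` (sub-cell-averaged finer kernel minus coarser):
`√(Σ_τ ‖K(x,τ)‖²) ≤ 48^{d+1}·√(n^{d+1}) · Ccol(d+1,L,a,m²,c)∕n² · e^{−κ|x|_∞}` — i.e. the ROOT-MEAN-SQUARE of the one-step difference over the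
`n^{d+1}` fine sites of the block at `y + τ∕n` is `≤ 48^{d+1}·Ccol∕n²·e^{−κ|y−y′|_∞}`: rate `θ = L⁻²` EXACTLY (`n = L^j`), n-free constant,
`j`-uniform exponential decay. -/
theorem subavg_kernel_rate_rms (d : ℕ) (aminus aplus m2plus : ℝ) (ha : 0 < aminus) (L : ℕ) [NeZero L] :
    ∃ κ c : ℝ, 0 < κ ∧ 0 < c ∧ ∀ (n : ℕ) [NeZero n] (a m2 : ℝ), aminus ≤ a → a ≤ aplus → 0 ≤ m2 → m2 ≤ m2plus →
      ∀ (x : Fin (d + 1) → ℤ),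
        Real.sqrt (sqNorm (fun τ : Fin (d + 1) → Fin n =>
            ((L : ℂ) ^ (d + 1))⁻¹ * ∑ ρ : Fin (d + 1) → Fin L, latticeKernel (G (n * L) a m2 (Tsub n L τ ρ)) x
              - latticeKernel (G n a m2 τ) x))
          ≤ 48 ^ (d + 1) * Real.sqrt ((n : ℝ) ^ (d + 1)) * (Ccol (d + 1) L a m2 c / (n : ℝ) ^ 2) * Real.exp (-(κ * supNorm x)) := by
  obtain ⟨κ, c, hκ, hc, h⟩ := subavg_kernel_rate_pairing d aminus aplus m2plus ha L
  refine ⟨κ, c, hκ, hc, ?_⟩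
  intro n _ a m2 ha1 ha2 hm hmp x
  set K : (Fin (d + 1) → Fin n) → ℂ := fun τ =>
    ((L : ℂ) ^ (d + 1))⁻¹ * ∑ ρ : Fin (d + 1) → Fin L, latticeKernel (G (n * L) a m2 (Tsub n L τ ρ)) x - latticeKernel (G n a m2 τ) x
  have hK := h n a m2 ha1 ha2 hm hmp K x
  have hCcol : 0 ≤ Ccol (d + 1) L a m2 c / (n : ℝ) ^ 2 := div_nonneg (Ccol_nonneg (d + 1) L (le_trans ha.le ha1) hm hc) (sq_nonneg _)
  -- the self-pairing is the squared norm
  have hself : ∑ τ : Fin (d + 1) → Fin n, conj (K τ) * K τ = ((sqNorm K : ℝ) : ℂ) := by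
    unfold sqNorm
    push_cast
    refine Finset.sum_congr rfl fun τ _ => ?_
    rw [Complex.conj_mul', ← Complex.ofReal_pow]
  have hK' : sqNorm K ≤ (Ccol (d + 1) L a m2 c / (n : ℝ) ^ 2
      * (Real.sqrt ((n : ℝ) ^ (d + 1) * 4 ^ (d + 1) * sqNorm K) * Real.sqrt ((576 : ℝ) ^ (d + 1))) * Real.exp (-(κ * supNorm x))) := by
    have := hK
    rw [hself, Complex.norm_real, Real.norm_eq_abs, abs_of_nonneg (sqNorm_nonneg K)] at this
    exact this
  -- rewrite the right side as `B · √(sqNorm K)`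
  have hsplit : Real.sqrt ((n : ℝ) ^ (d + 1) * 4 ^ (d + 1) * sqNorm K) = Real.sqrt ((n : ℝ) ^ (d + 1)) * 2 ^ (d + 1) * Real.sqrt (sqNorm K) := by
    rw [Real.sqrt_mul (by positivity), Real.sqrt_mul (by positivity)]
    congr 1
    rw [show ((4 : ℝ) ^ (d + 1)) = (2 ^ (d + 1)) ^ 2 by rw [← pow_mul, mul_comm, pow_mul]; norm_num, Real.sqrt_sq (by positivity)]
  have h576 : Real.sqrt ((576 : ℝ) ^ (d + 1)) = 24 ^ (d + 1) := by
    rw [show ((576 : ℝ) ^ (d + 1)) = (24 ^ (d + 1)) ^ 2 by rw [← pow_mul, mul_comm, pow_mul]; norm_num, Real.sqrt_sq (by positivity)]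
  rw [hsplit, h576] at hK'
  have hB : 0 ≤ 48 ^ (d + 1) * Real.sqrt ((n : ℝ) ^ (d + 1)) * (Ccol (d + 1) L a m2 c / (n : ℝ) ^ 2) * Real.exp (-(κ * supNorm x)) := by
    positivity
  refine sqrt_sqNorm_le_of_self_pairing K hB ?_
  calc sqNorm K ≤ Ccol (d + 1) L a m2 c / (n : ℝ) ^ 2
        * (Real.sqrt ((n : ℝ) ^ (d + 1)) * 2 ^ (d + 1) * Real.sqrt (sqNorm K) * 24 ^ (d + 1)) * Real.exp (-(κ * supNorm x)) := hK'
    _ = 48 ^ (d + 1) * Real.sqrt ((n : ℝ) ^ (d + 1)) * (Ccol (d + 1) L a m2 c / (n : ℝ) ^ 2) * Real.exp (-(κ * supNorm x))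
        * Real.sqrt (sqNorm K) := by
        rw [show (48 : ℝ) ^ (d + 1) = 2 ^ (d + 1) * 24 ^ (d + 1) by rw [← mul_pow]; norm_num]
        ring

end Summit.QuantumFields.BalabanUV.Beta.GAN24.SubAveragingKernelL2
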